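import Literature.Analysis.FluidPDE.NSCriticalClosureHolds
import Literature.Analysis.FluidPDE.ClayClassLerayHopfUniqueness
import Literature.Analysis.FluidPDE.NSLerayExistenceR3Holds
import Literature.Analysis.FluidPDE.LerayLocalRegularH1Proofs
import Literature.Analysis.FluidPDE.WeakSolutionWeakContinuity
import Literature.Analysis.FluidPDE.NSLerayStrongLocalExistence
import Literature.Analysis.FluidPDE.NSTaoClassOfSobolevDatum
import HarnessLib

/-!
# Finite-energy classical solutions with `sup_{[0,T)} ‖u(t)‖_{L³} < ∞`, or in a Serrin class
# `L^q_tL^r_x`, continue to the closed slab (Escauriaza–Seregin–Šverák 2003, Thm. 1.4 / Seregin 2012,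
# Thm. 1.1; Ladyzhenskaya–Prodi–Serrin — in the finite-energy classical class on `ℝ³`) — PROVED

Analysis/FluidPDE proof file (theorems only; no definition, no named fact). The tree proves the
Escauriaza–Seregin–Šverák continuation criterion in the form
`hasSmoothExtensionPast_of_eLpNorm_three_bounded_holds`: a classical solution on `[0, T) × ℝ³` which is
ALSO a Leray–Hopf weak solution on `[0, T)` (tree structure `IsLerayHopfOn T`, whose clauses see the
endpoint slice `u T` and weak `L²` continuity on `(0, T]`) from a rapidly decaying datum, with
`sup_{0 ≤ t < T} ‖u(t)‖_{L³} < ∞`, extends as a classical solution past `T`. The claimed proofs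
adjudicated by the cell `ns-claims` (D-0090) and the Clay reference files
(`Literature/Claims/NS/ClayR3*.lean`) work instead with the FINITE-ENERGY CLASSICAL class on
half-open slabs `[0, T)` (Tao 2013, (6): `sup_{t<T} ∫|u(t)|² < ∞`), in which the velocity at the
would-be blow-up time `T` is not given. This file supplies the glue:

* (private) `IsLerayHopfOn.congr_slice_zero` — a Leray–Hopf solution of the unforced system may be redefined
  at `t = 0` by its datum (every clause of the definition lives on `(0, T]` or a.e. in time, except
  the `L²` membership and the energy inequality at `t = 0`, which hold trivially for the datum);
* (private) `lintegral_enorm_sq_endpoint_le` — Fatou at the endpoint: a field jointly continuous on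
  `[0, T] × ℝ³` with `∫|w(t)|² ≤ A` for `t < T` has `∫|w(T)|² ≤ A`;
* `IsClassicalNSSolutionOn.ae_eq_of_isLerayHopfOn_Icc` / `…_Ico` — weak–strong uniqueness against
  a finite-energy classical solution: a Leray–Hopf solution with the same (rapidly decaying) datum
  agrees with it a.e. at every time of the slab (Tao 2013 Lemma 8.1: the classical solution is
  Leray–Hopf on every closed sub-slab, `isLerayHopfOn_of_finiteEnergy`; Tao 2013 Cor. 11.1 +
  Sobolev: it is bounded there, `tao2011_hasBoundedSobolevNormsOn.closedSlab`; Prodi–Serrin at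
  `q = r = ∞`, `weak_strong_uniqueness_holds`);
* `IsClassicalNSSolutionOn.exists_Icc_of_eLpNorm_three_bounded` — **the continuation theorem**:
  `ν > 0`, `(u, p)` a classical solution of the unforced system on `[0, T) × ℝ³`, `T > 0`, with
  rapidly decaying datum `u 0`, energy bounded on `[0, T)` and `sup_{t ∈ [0,T)} ‖u(t)‖_{L³} < ∞`;
  then there is a classical solution `(u', p')` on the CLOSED slab `[0, T] × ℝ³` with `u' = u` on
  `[0, T)` and energy bounded on `[0, T]`. Proof: Leray's global weak solution `v` from `u 0`
  (`leray_existence_R3_holds`), redefined at `t = 0` by the datum, agrees a.e. with `u` at every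
  time of `(0, T)`; the glued field `w = u` on `[0, T)`, `w = v` from `T` on, is classical on
  `[0, T)` (`IsClassicalNSSolutionOn.congr_velocity`) AND Leray–Hopf on `[0, T)` with its endpoint
  slice (`IsLerayHopfOn.congr_ae_slices`); ESS gives a classical extension past `T`, whose energy at
  `t = T` is bounded by Fatou.

* `IsClassicalNSSolutionOn.exists_supBound_of_memLqLp` — **the Ladyzhenskaya–Prodi–Serrin form**:
  under the same hypotheses with `u ∈ L^q(0,T; L^r)`, `3 < r ≤ ∞`, `2/q + 3/r ≤ 1`, in place of the
  `L³` bound, `u` is BOUNDED on `[0, T) × ℝ³` (the Leray–Hopf glue is in the Serrin class; the tree's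
  `ladyzhenskaya_prodi_serrin_holds` gives a classical representative on `(0, T]`; Tao's Cor. 11.1 on
  `[0, T/2]` from the datum and on `[T/2, T]` for the translated representative, whose datum `u(T/2)`
  is `H^∞` and whose endpoint energy is bounded by Fatou).

The Clay-form consequences ((A) ⇔ an a priori `L³` bound / an a priori `L^q_tL^r_x` bound; blow-up
certificates ⇒ (C)) are in `Literature/Claims/NS/ClayR3L3Bridge.lean` and
`Literature/Claims/NS/ClayR3SerrinBridge.lean`.

WHAT THIS IS NOT: not a claim about NS regularity or blow-up; not a claim about any author beyond the
typed locator.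

## References
* L. Escauriaza, G. Seregin, V. Šverák, Russ. Math. Surveys 58 (2003) 211–250, Thms. 1.3–1.4.
  [EscauriazaSereginSverak2003]
* G. Seregin, Comm. Math. Phys. 312 (2012) 833–845, Thm. 1.1. [Seregin2012CMP]
* T. Tao, Anal. PDE 6 (2013) 25–107 = arXiv:1108.1165, Lemma 8.1, Cor. 11.1. [Tao2011]
* J. Leray, Acta Math. 63 (1934), §III Thm. of §34 (existence), §33. [Leray1934]
* J. Serrin, in: Nonlinear Problems (1963), Thm. 6; J. C. Robinson, J. L. Rodrigo, W. Sadowski,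
  CUP 2016, Thm. 8.19. [RobinsonRodrigoSadowski2016]
-/

noncomputable section

open MeasureTheory Set Function Filter Topology
open scoped ENNReal NNReal ContDiff InnerProductSpace

namespace Literature.Analysis.FluidPDE

/-! ### Redefining a Leray–Hopf solution at `t = 0` -/

section SliceZero

variable {E : Type*} [NormedAddCommGroup E] [InnerProductSpace ℝ E] [FiniteDimensional ℝ E]
  [MeasurableSpace E] [BorelSpace E]
variable {T ν : ℝ} {u₀ : E → E} {u v : ℝ → E → E}

/-- **A Leray–Hopf solution of the unforced system may be changed at `t = 0` into its datum**: if
`v t = u t` for every `t > 0`, `v 0 = u₀` and `u₀ ∈ L²`, then `v` is a Leray–Hopf solution on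
`[0, T)` with the same viscosity and datum (the weak formulation, the `L^∞_tL²_x` bound, the weak
gradients and the energy inequalities from a.e. `s > 0`, the weak `L²` continuity on `(0, T]` and the
strong initial trace only see times `t > 0` or a.e. `t`; at `t = 0` the `L²` membership is `u₀ ∈ L²`
and the energy inequality from `0` is an equality). `E`-side twin of the tree's torus lemma
`Torus.IsLerayHopfOn.congr_of_eqOn_Ioi`. Private helper of the continuation theorem below. [folklore] -/
private theorem IsLerayHopfOn.congr_slice_zero (h : IsLerayHopfOn T ν 0 u₀ u)
    (hv : ∀ t, 0 < t → v t = u t) (hv0 : v 0 = u₀) (hu₀ : MemLp u₀ 2 volume) :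
    IsLerayHopfOn T ν 0 u₀ v := by
  have hIoo : ∀ t ∈ Ioo 0 T, v t = u t := fun t ht => hv t ht.1
  have hae : ∀ᵐ t ∂(volume.restrict (Ioo 0 T)), v t = u t := by
    filter_upwards [ae_restrict_mem measurableSet_Ioo] with t ht using hIoo t ht
  obtain ⟨G, hG, hGint, hE0, hEs⟩ := h.weakGrad_energy
  refine
    { weak := h.weak.congr_ae_slice hae
      energy_bound := ?_
      memLp := fun t ht => ?_
      weakGrad_energy := ⟨G, ?_, hGint, fun t ht => ?_, ?_⟩
      weak_continuous := fun w hw => ?_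
      strong_initial := ?_ }
  · -- `L^∞_t L²_x`
    obtain ⟨C, hC⟩ := h.energy_bound
    refine ⟨C, ?_⟩
    filter_upwards [hC, ae_restrict_mem measurableSet_Ioo] with t ht htI
    rwa [hIoo t htI]
  · -- every slice in `L²`
    rcases ht.1.eq_or_lt with h0 | h0
    · rw [← h0, hv0]; exact hu₀
    · rw [hv t h0]; exact h.memLp t ht
  · -- weak gradients, a.e. in time
    filter_upwards [hG, ae_restrict_mem measurableSet_Ioo] with t ht htI
    rwa [hIoo t htI]
  · -- energy inequality from `0`
    rcases ht.1.eq_or_lt with h0 | h0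
    · subst h0
      simp [hv0]
    · have h1 := hE0 t ht
      rw [hv t h0]
      simpa only [Pi.zero_apply, inner_zero_left, integral_zero, intervalIntegral.integral_zero]
        using h1
  · -- energy inequalities from a.e. `s > 0`
    filter_upwards [hEs, ae_restrict_mem measurableSet_Ioo] with s hs hsI t ht
    have h1 := hs t ht
    rw [hv t (hsI.1.trans_le ht.1), hv s hsI.1]
    simpa only [Pi.zero_apply, inner_zero_left, integral_zero, intervalIntegral.integral_zero]
      using h1
  · -- weak continuity into `L²` on `(0, T]`, weak limit at `0⁺`
    obtain ⟨hc, hl⟩ := h.weak_continuous w hw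
    refine ⟨hc.congr fun t ht => by simp only [hv t ht.1], hl.congr' ?_⟩
    filter_upwards [self_mem_nhdsWithin] with t ht
    simp only [hv t ht]
  · -- strong initial trace
    refine h.strong_initial.congr' ?_
    filter_upwards [self_mem_nhdsWithin] with t ht
    simp only [hv t ht]

end SliceZero

/-! ### Fatou at the endpoint of a closed slab -/

section Endpoint

variable {F : Type*} [NormedAddCommGroup F] [NormedSpace ℝ F]

/-- **Fatou at the endpoint.** If `w` is jointly smooth on `[0, T] × ℝ³`, `T > 0`, and
`∫ ‖w(t)‖² ≤ A` for every `t ∈ [0, T)`, then `∫ ‖w(T)‖² ≤ A`: along `tₙ = T·n/(n+1) ↑ T` the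
slices converge pointwise, and `∫ liminf ≤ liminf ∫` (Fatou). Private helper of the continuation theorem
below. [folklore] -/
private theorem lintegral_enorm_sq_endpoint_le {T : ℝ} (hT : 0 < T)
    {w : ℝ → EuclideanSpace ℝ (Fin 3) → F} {A : ℝ≥0∞}
    (hw : IsSmoothSpaceTimeOn (Icc 0 T) w) (hb : ∀ t ∈ Ico 0 T, ∫⁻ x, ‖w t x‖ₑ ^ 2 ≤ A) :
    ∫⁻ x, ‖w T x‖ₑ ^ 2 ≤ A := by
  -- the times `tₙ = T · n/(n+1)`
  set s : ℕ → ℝ := fun n => T * ((n : ℝ) / ((n : ℝ) + 1)) with hs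
  have hs_mem : ∀ n, s n ∈ Ico 0 T := fun n => by
    refine ⟨by positivity, ?_⟩
    have h1 : (n : ℝ) / ((n : ℝ) + 1) < 1 := by
      rw [div_lt_one (by positivity)]
      exact lt_add_one _
    calc T * ((n : ℝ) / ((n : ℝ) + 1)) < T * 1 := by gcongr
      _ = T := mul_one T
  have hs_lim : Tendsto s atTop (𝓝 T) := by
    have h1 := (tendsto_natCast_div_add_atTop (1 : ℝ)).const_mul T
    rw [mul_one] at h1
    exact h1
  have hs_lim' : Tendsto s atTop (𝓝[Icc 0 T] T) :=
    tendsto_nhdsWithin_iff.2 ⟨hs_lim, Eventually.of_forall fun n => Ico_subset_Icc_self (hs_mem n)⟩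
  -- pointwise convergence of the slices at every `x`
  have hpt : ∀ x, Tendsto (fun n => ‖w (s n) x‖ₑ ^ 2) atTop (𝓝 (‖w T x‖ₑ ^ 2)) := by
    intro x
    have hc : ContinuousWithinAt (fun t => w t x) (Icc 0 T) T := by
      have h2 : ContinuousWithinAt (uncurry w) (Icc 0 T ×ˢ univ) ((fun t : ℝ => (t, x)) T) :=
        hw.continuousOn (T, x) ⟨right_mem_Icc.2 hT.le, mem_univ _⟩
      have h3 : ContinuousWithinAt (fun t : ℝ => (t, x)) (Icc 0 T) T :=
        (continuous_id.prodMk continuous_const).continuousWithinAt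
      exact ContinuousWithinAt.comp (f := fun t : ℝ => (t, x)) h2 h3 fun t ht => ⟨ht, mem_univ _⟩
    have h4 : Tendsto (fun n => w (s n) x) atTop (𝓝 (w T x)) := hc.tendsto.comp hs_lim'
    exact ((ENNReal.continuous_pow 2).tendsto _).comp ((continuous_enorm.tendsto _).comp h4)
  have hmeas : ∀ n, AEMeasurable (fun x => ‖w (s n) x‖ₑ ^ 2) volume := fun n =>
    ((hw.contDiff_slice (Ico_subset_Icc_self (hs_mem n))).continuous.aestronglyMeasurable
      (μ := volume)).enorm.pow_const 2
  calc ∫⁻ x, ‖w T x‖ₑ ^ 2 = ∫⁻ x, liminf (fun n => ‖w (s n) x‖ₑ ^ 2) atTop :=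
        lintegral_congr fun x => ((hpt x).liminf_eq).symm
    _ ≤ liminf (fun n => ∫⁻ x, ‖w (s n) x‖ₑ ^ 2) atTop := lintegral_liminf_le' hmeas
    _ ≤ A := Filter.liminf_le_of_frequently_le'
        ((Eventually.of_forall fun n => hb _ (hs_mem n)).frequently)

end Endpoint

/-! ### Weak–strong uniqueness against a finite-energy classical solution -/

section WeakStrong

variable {ν T : ℝ} {u v : ℝ → EuclideanSpace ℝ (Fin 3) → EuclideanSpace ℝ (Fin 3)}
  {p : ℝ → EuclideanSpace ℝ (Fin 3) → ℝ}

/-- **A Leray–Hopf solution agrees with a finite-energy classical solution on a closed slab.** Let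
`ν > 0`, `T > 0`, `(u, p)` a classical solution of the unforced system on `[0, T] × ℝ³` with finite
energy (Tao's (6)) and rapidly decaying datum `u 0`, and `v` a Leray–Hopf weak solution on `[0, T)`
from `u 0`. Then `v(t) = u(t)` a.e. for every `t ∈ (0, T]`: `u` is itself Leray–Hopf (Tao 2013,
Lemma 8.1 with Lemma 4.1 (i); `isLerayHopfOn_of_finiteEnergy`) and lies in `L^∞((0,T); L^∞)`
(Tao 2013, Cor. 11.1 + Sobolev; `tao2011_hasBoundedSobolevNormsOn.closedSlab`), so Prodi–Serrin
weak–strong uniqueness at `q = r = ∞` applies (`weak_strong_uniqueness_holds`).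
[cite: Tao2011, Lemma 8.1 and Cor. 11.1] [cite: RobinsonRodrigoSadowski2016, Thm. 8.19] -/
theorem IsClassicalNSSolutionOn.ae_eq_of_isLerayHopfOn_Icc (hν : 0 < ν) (hT : 0 < T)
    (hcl : IsClassicalNSSolutionOn (Icc 0 T) ν 0 u p) (hdec : HasRapidSpatialDecay (u 0))
    (hfe : ∃ A : ℝ≥0∞, A < ⊤ ∧ ∀ t ∈ Icc 0 T, ∫⁻ x, ‖u t x‖ₑ ^ 2 ≤ A)
    (hv : IsLerayHopfOn T ν 0 (u 0) v) : ∀ t ∈ Ioc 0 T, v t =ᵐ[volume] u t := by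
  have hLH : IsLerayHopfOn T ν 0 (u 0) u :=
    (_root_.Literature.Analysis.FluidPDE.isLerayHopfOn_of_finiteEnergy hcl hν hT hfe).1
  have hS : MemLqLp ⊤ ⊤ u (Ioo 0 T) :=
    (tao2011_hasBoundedSobolevNormsOn.closedSlab tao2011_hasBoundedSobolevNormsOn_holds
      linfty_bound_of_hasBoundedSobolevNormsOn_holds ν T hν hT u p hcl hfe hdec).2
  have hr : (3 : ℝ≥0∞) < ⊤ := by simp
  have hqr : (2 : ℝ≥0∞) / ⊤ + 3 / ⊤ ≤ 1 := by simp [ENNReal.div_top]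
  exact weak_strong_uniqueness_holds hν hT hLH hr hqr hS hv

/-- **The same on a half-open slab `[0, T)`**, slab by closed sub-slab: if `(u, p)` is a classical
solution on `[0, T) × ℝ³` with energy bounded on `[0, T)` and rapidly decaying datum, and `v` is
Leray–Hopf on `[0, t)` from `u 0` for every `t ∈ (0, T)` (e.g. a global Leray–Hopf solution), then
`v(t) = u(t)` a.e. for every `t ∈ (0, T)`. [cite: Tao2011, Lemma 8.1 and Cor. 11.1]
[cite: RobinsonRodrigoSadowski2016, Thm. 8.19] -/
theorem IsClassicalNSSolutionOn.ae_eq_of_isLerayHopfOn_Ico (hν : 0 < ν)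
    (hcl : IsClassicalNSSolutionOn (Ico 0 T) ν 0 u p) (hdec : HasRapidSpatialDecay (u 0))
    (hfe : ∃ A : ℝ≥0∞, A < ⊤ ∧ ∀ t ∈ Ico 0 T, ∫⁻ x, ‖u t x‖ₑ ^ 2 ≤ A)
    (hv : ∀ t ∈ Ioo 0 T, IsLerayHopfOn t ν 0 (u 0) v) : ∀ t ∈ Ioo 0 T, v t =ᵐ[volume] u t := by
  intro t ht
  have hcl' : IsClassicalNSSolutionOn (Icc 0 t) ν 0 u p :=
    hcl.mono (Icc_subset_Ico_right ht.2) (uniqueDiffOn_Icc ht.1)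
  obtain ⟨A, hA, hb⟩ := hfe
  exact hcl'.ae_eq_of_isLerayHopfOn_Icc hν ht.1 hdec
    ⟨A, hA, fun s hs => hb s ⟨hs.1, hs.2.trans_lt ht.2⟩⟩ (hv t ht) t ⟨ht.1, le_rfl⟩

end WeakStrong

/-! ### The continuation theorem -/

section Continuation

variable {ν T : ℝ} {u : ℝ → EuclideanSpace ℝ (Fin 3) → EuclideanSpace ℝ (Fin 3)}
  {p : ℝ → EuclideanSpace ℝ (Fin 3) → ℝ}

/-- **The Leray–Hopf glue** (private): for a finite-energy classical solution `(u, p)` on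
`[0, T) × ℝ³`, `T > 0`, with rapidly decaying datum, there is a field `w` with `w = u` on `[0, T)` which
is at once a classical solution on `[0, T)` (same pressure) and a Leray–Hopf weak solution on `[0, T)`
in the tree's strict sense (endpoint slice and weak continuity at `T` included): `w` is `u` on
`[0, T)` and Leray's global weak solution from `u 0` from `T` on. [folklore] -/
private theorem IsClassicalNSSolutionOn.exists_lerayHopf_glue (hν : 0 < ν) (hT : 0 < T)
    (hcl : IsClassicalNSSolutionOn (Ico 0 T) ν 0 u p) (hdec : HasRapidSpatialDecay (u 0))
    (hfe : ∃ A : ℝ≥0∞, A < ⊤ ∧ ∀ t ∈ Ico 0 T, ∫⁻ x, ‖u t x‖ₑ ^ 2 ≤ A) :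
    ∃ w : ℝ → EuclideanSpace ℝ (Fin 3) → EuclideanSpace ℝ (Fin 3),
      IsClassicalNSSolutionOn (Ico 0 T) ν 0 w p ∧ (∀ t ∈ Ico 0 T, w t = u t) ∧
        IsLerayHopfOn T ν 0 (u 0) w := by
  classical
  have h0mem : (0 : ℝ) ∈ Ico 0 T := ⟨le_rfl, hT⟩
  have hs0 : ContDiff ℝ ∞ (u 0) := hcl.contDiff_velocity h0mem
  have hdiv0 : VectorCalculus.IsDivFree (u 0) := hcl.divFree 0 h0mem
  -- the datum: `L²`, weakly divergence free
  have hL2 : ∫⁻ x, ‖u 0 x‖ₑ ^ 2 < ⊤ := by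
    refine lt_of_le_of_lt (le_of_eq (lintegral_congr fun x => ?_))
      (hdec.lintegral_enorm_iteratedFDeriv_sq_lt_top (μ := volume) 0)
    rw [← ofReal_norm, ← ofReal_norm, norm_iteratedFDeriv_zero]
  have hu2 : MemLp (u 0) 2 volume :=
    ⟨hs0.continuous.aestronglyMeasurable, eLpNorm_two_lt_top_of_lintegral_enorm_sq_lt_top hL2⟩
  have hwdiv : IsWeaklyDivFree (u 0) :=
    VectorCalculus.IsDivFree.isWeaklyDivFree_holds hdiv0 (hs0.of_le (mod_cast le_top))
  -- Leray's global weak solution from the datum, redefined at `t = 0`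
  obtain ⟨v, hv⟩ := leray_existence_R3_holds ν hν (u 0) hu2 hwdiv
  set v' : ℝ → EuclideanSpace ℝ (Fin 3) → EuclideanSpace ℝ (Fin 3) :=
    fun t => if t = 0 then u 0 else v t with hv'_def
  have hv'LH : IsLerayHopfOn T ν 0 (u 0) v' :=
    (hv T hT).congr_slice_zero (fun t ht => by simp only [hv'_def, if_neg ht.ne'])
      (by simp only [hv'_def, if_pos rfl]) hu2
  -- the glued field: `u` on `[0, T)`, Leray's solution from `T` on
  set w : ℝ → EuclideanSpace ℝ (Fin 3) → EuclideanSpace ℝ (Fin 3) :=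
    fun t => if t < T then u t else v t with hw_def
  have hwu : ∀ t ∈ Ico 0 T, w t = u t := fun t ht => by simp only [hw_def, if_pos ht.2]
  have hwcl : IsClassicalNSSolutionOn (Ico 0 T) ν 0 w p := hcl.congr_velocity hwu
  have hw0 : w 0 = u 0 := hwu 0 h0mem
  -- the slices of `w` agree a.e. with those of `v'` on `[0, T]`
  have hae : ∀ t ∈ Ioo 0 T, v t =ᵐ[volume] u t :=
    hcl.ae_eq_of_isLerayHopfOn_Ico hν hdec hfe fun t ht => hv t ht.1
  have hwv' : ∀ t ∈ Icc 0 T, w t =ᵐ[volume] v' t := by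
    intro t ht
    rcases ht.1.eq_or_lt with h0 | h0
    · subst h0
      rw [hw0]
      simp only [hv'_def, if_pos rfl]
      exact EventuallyEq.rfl
    · have hv't : v' t = v t := by simp only [hv'_def, if_neg h0.ne']
      rcases ht.2.lt_or_eq with htT | htT
      · rw [hwu t ⟨ht.1, htT⟩, hv't]
        exact (hae t ⟨h0, htT⟩).symm
      · rw [hv't, htT]
        simp only [hw_def, lt_irrefl, if_false]
        exact EventuallyEq.rfl
  -- measurability of `w` on the open strip (it is `u` there, continuous)
  have hwm : AEStronglyMeasurable (uncurry w)
      (volume.restrict (Ioo 0 T ×ˢ (univ : Set (EuclideanSpace ℝ (Fin 3))))) := by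
    have hmeasS : MeasurableSet (Ioo 0 T ×ˢ (univ : Set (EuclideanSpace ℝ (Fin 3)))) :=
      measurableSet_Ioo.prod MeasurableSet.univ
    have hcont : ContinuousOn (uncurry u) (Ioo 0 T ×ˢ (univ : Set (EuclideanSpace ℝ (Fin 3)))) :=
      hcl.smooth_velocity.continuousOn.mono (prod_mono Ioo_subset_Ico_self Subset.rfl)
    refine (hcont.aestronglyMeasurable hmeasS).congr ?_
    filter_upwards [ae_restrict_mem hmeasS] with z hz
    obtain ⟨t, x⟩ := z
    simp only [uncurry_apply_pair, hwu t (Ioo_subset_Ico_self (mem_prod.1 hz).1)]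
  exact ⟨w, hwcl, hwu, hv'LH.congr_ae_slices hT hwm hwv'⟩

/-- **Escauriaza–Seregin–Šverák continuation in the finite-energy classical class.** Let `ν > 0`,
`T > 0`, and let `(u, p)` be a classical solution of the unforced Navier–Stokes system on
`[0, T) × ℝ³` whose datum `u 0` has rapidly decaying derivatives of all orders, with energy bounded on
`[0, T)` and `sup_{t ∈ [0,T)} ‖u(t)‖_{L³} < ∞`. Then there is a classical solution `(u', p')` on the
CLOSED slab `[0, T] × ℝ³` with `u' = u` on `[0, T)` and energy bounded on `[0, T]` (so that, by the
tree's local theory, `u` continues past `T` in the class). Assembly: Leray's global weak solution from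
`u 0` (Leray 1934; `leray_existence_R3_holds`), redefined at `t = 0` by the datum
(`IsLerayHopfOn.congr_slice_zero`), agrees a.e. with `u` at every time of `(0, T)`
(`ae_eq_of_isLerayHopfOn_Ico`); gluing its slices from `T` on to `u` gives a field that is classical
on `[0, T)` and Leray–Hopf on `[0, T)` (`IsLerayHopfOn.congr_ae_slices`), to which the tree's ESS
theorem `hasSmoothExtensionPast_of_eLpNorm_three_bounded_holds` applies; the energy of the extension
at `t = T` is bounded by Fatou (`lintegral_enorm_sq_endpoint_le`).
[cite: EscauriazaSereginSverak2003, Thm. 1.4] [cite: Seregin2012CMP, Thm. 1.1]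
[cite: Tao2011, Lemma 8.1 and Cor. 11.1] [cite: Leray1934, §34] -/
theorem IsClassicalNSSolutionOn.exists_Icc_of_eLpNorm_three_bounded (hν : 0 < ν) (hT : 0 < T)
    (hcl : IsClassicalNSSolutionOn (Ico 0 T) ν 0 u p) (hdec : HasRapidSpatialDecay (u 0))
    (hfe : ∃ A : ℝ≥0∞, A < ⊤ ∧ ∀ t ∈ Ico 0 T, ∫⁻ x, ‖u t x‖ₑ ^ 2 ≤ A)
    (hL3 : (⨆ t ∈ Ico 0 T, eLpNorm (u t) 3 volume) < ⊤) :
    ∃ (u' : ℝ → EuclideanSpace ℝ (Fin 3) → EuclideanSpace ℝ (Fin 3))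
      (p' : ℝ → EuclideanSpace ℝ (Fin 3) → ℝ),
      IsClassicalNSSolutionOn (Icc 0 T) ν 0 u' p' ∧ (∀ t ∈ Ico 0 T, u' t = u t) ∧
        ∃ A : ℝ≥0∞, A < ⊤ ∧ ∀ t ∈ Icc 0 T, ∫⁻ x, ‖u' t x‖ₑ ^ 2 ≤ A := by
  obtain ⟨w, hwcl, hwu, hwLH⟩ := hcl.exists_lerayHopf_glue hν hT hdec hfe
  have hw0 : w 0 = u 0 := hwu 0 ⟨le_rfl, hT⟩
  rw [← hw0] at hwLH
  have hdecw : HasRapidSpatialDecay (w 0) := by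
    rw [hw0]
    exact hdec
  have hL3w : (⨆ t ∈ Ico 0 T, eLpNorm (w t) 3 volume) < ⊤ := by
    refine lt_of_le_of_lt (le_of_eq (biSup_congr fun t ht => ?_)) hL3
    rw [hwu t ht]
  -- Escauriaza–Seregin–Šverák: a classical extension past `T`
  obtain ⟨T', hT', u', p', hcl', heq⟩ :=
    hasSmoothExtensionPast_of_eLpNorm_three_bounded_holds ν T hν hT w p hwcl hwLH hdecw hL3w
  have heq' : ∀ t ∈ Ico 0 T, u' t = u t := fun t ht => (heq t ht).trans (hwu t ht)
  have hcl'T : IsClassicalNSSolutionOn (Icc 0 T) ν 0 u' p' :=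
    hcl'.mono (Icc_subset_Ico_right hT') (uniqueDiffOn_Icc hT)
  obtain ⟨A, hA, hb⟩ := hfe
  refine ⟨u', p', hcl'T, heq', A, hA, fun t ht => ?_⟩
  rcases ht.2.lt_or_eq with htT | htT
  · rw [heq' t ⟨ht.1, htT⟩]
    exact hb t ⟨ht.1, htT⟩
  · rw [htT]
    exact lintegral_enorm_sq_endpoint_le hT hcl'T.smooth_velocity fun s hs => by
      rw [heq' s hs]
      exact hb s hs

/-- **Ladyzhenskaya–Prodi–Serrin in the finite-energy classical class: an a priori `L^q_tL^r_x` bound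
on a half-open slab bounds the solution.** Let `ν > 0`, `T > 0`, `(u, p)` a classical solution of the
unforced system on `[0, T) × ℝ³` with rapidly decaying datum `u 0` and energy bounded on `[0, T)`, and
`u ∈ L^q(0,T; L^r(ℝ³))` with `3 < r ≤ ∞`, `2/q + 3/r ≤ 1`. Then `u` is BOUNDED on `[0, T) × ℝ³` (so
it continues past `T` in the class, by the blow-up alternative). Assembly: the Leray–Hopf glue of
`exists_Icc_of_eLpNorm_three_bounded` is in the Serrin class, so the tree's Prodi–Serrin regularity
theorem `ladyzhenskaya_prodi_serrin_holds` (Serrin 1962; Robinson–Rodrigo–Sadowski Thm. 8.17) gives a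
classical representative `v` on `(0, T]`, equal to `u` on `(0, T)` (continuous slices, a.e. equal); on
`[0, T/2]` the solution is bounded by Tao's Cor. 11.1 from the datum
(`exists_norm_iteratedFDeriv_le_of_sobolevDatum`), on `[T/2, T)` by the same corollary applied to the
translate `v(· + T/2)` on the CLOSED slab `[0, T/2]`, whose datum `u(T/2)` is `H^∞`
(`hasBoundedSobolevNormsOn_of_sobolevDatum_unforced`) and whose energy at the endpoint is bounded by
Fatou. [cite: Serrin1962, Thm. (regularity in L^qL^r)] [cite: RobinsonRodrigoSadowski2016, Thm. 8.17]
[cite: Tao2011, Lemma 8.1 and Cor. 11.1] [cite: Leray1934, §34] -/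
theorem IsClassicalNSSolutionOn.exists_supBound_of_memLqLp (hν : 0 < ν) (hT : 0 < T)
    (hcl : IsClassicalNSSolutionOn (Ico 0 T) ν 0 u p) (hdec : HasRapidSpatialDecay (u 0))
    (hfe : ∃ A : ℝ≥0∞, A < ⊤ ∧ ∀ t ∈ Ico 0 T, ∫⁻ x, ‖u t x‖ₑ ^ 2 ≤ A)
    {q r : ℝ≥0∞} (hr : 3 < r) (hqr : 2 / q + 3 / r ≤ 1) (hS : MemLqLp q r u (Ioo 0 T)) :
    ∃ M : ℝ, ∀ t ∈ Ico 0 T, ∀ x, ‖u t x‖ ≤ M := by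
  obtain ⟨w, hwcl, hwu, hwLH⟩ := hcl.exists_lerayHopf_glue hν hT hdec hfe
  -- the glued field is in the Serrin class (its slices on `(0, T)` are those of `u`)
  have hSw : MemLqLp q r w (Ioo 0 T) := by
    refine hS.congr_ae_slice ?_
    filter_upwards [ae_restrict_mem measurableSet_Ioo] with t ht
    rw [hwu t (Ioo_subset_Ico_self ht)]
  -- Prodi–Serrin: a classical representative on `(0, T]`
  obtain ⟨v, p', hv, hvae⟩ := ladyzhenskaya_prodi_serrin_holds hν hT hwLH hr hqr hSw
  have heq : ∀ t ∈ Ioo 0 T, v t = u t := by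
    intro t ht
    have h1 : u t =ᵐ[volume] v t := by
      rw [← hwu t (Ioo_subset_Ico_self ht)]
      exact hvae t ⟨ht.1, ht.2.le⟩
    exact ((Continuous.ae_eq_iff_eq volume (hcl.contDiff_velocity (Ioo_subset_Ico_self ht)).continuous
      (hv.contDiff_velocity ⟨ht.1, ht.2.le⟩).continuous).1 h1).symm
  obtain ⟨A, hA, hb⟩ := hfe
  have hT2 : 0 < T / 2 := half_pos hT
  have hT2T : T / 2 < T := half_lt_self hT
  -- the datum is `H^∞`
  have h₀ : ∀ m : ℕ, ∫⁻ x, ‖iteratedFDeriv ℝ m (u 0) x‖ₑ ^ 2 < ⊤ := fun m =>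
    hdec.lintegral_enorm_iteratedFDeriv_sq_lt_top (μ := volume) m
  have hf0 : ∀ m : ℕ, ∃ C : ℝ≥0, ∀ t ∈ Icc 0 (T / 2),
      ∫⁻ x, ‖iteratedFDeriv ℝ m
        ((0 : ℝ → EuclideanSpace ℝ (Fin 3) → EuclideanSpace ℝ (Fin 3)) t) x‖ₑ ^ 2 ≤ C :=
    fun m => ⟨0, fun t _ => by simp⟩
  -- first half `[0, T/2]`: bounded by Tao's Cor. 11.1 from the datum
  have hcl1 : IsClassicalNSSolutionOn (Icc 0 (T / 2)) ν 0 u p :=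
    hcl.mono (Icc_subset_Ico_right hT2T) (uniqueDiffOn_Icc hT2)
  have hE1 : ∃ C : ℝ≥0, ∀ t ∈ Icc 0 (T / 2), ∫⁻ x, ‖u t x‖ₑ ^ 2 ≤ C :=
    ⟨A.toNNReal, fun t ht => (hb t ⟨ht.1, ht.2.trans_lt hT2T⟩).trans (ENNReal.coe_toNNReal hA.ne).ge⟩
  obtain ⟨B₁, -, hB₁⟩ := hcl1.exists_norm_iteratedFDeriv_le_of_sobolevDatum hν hT2 hE1 h₀ hf0 0
  -- second half: the translate `V = v(· + T/2)` on the closed slab `[0, T/2]`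
  set V : ℝ → EuclideanSpace ℝ (Fin 3) → EuclideanSpace ℝ (Fin 3) := fun s => v (s + T / 2)
    with hV_def
  set P : ℝ → EuclideanSpace ℝ (Fin 3) → ℝ := fun s => p' (s + T / 2) with hP_def
  have hVcl : IsClassicalNSSolutionOn (Icc 0 (T / 2)) ν 0 V P :=
    (hv.comp_add_right (T / 2)).mono
      (fun s hs => show s + T / 2 ∈ Ioc 0 T from ⟨by linarith [hs.1], by linarith [hs.2]⟩)
      (uniqueDiffOn_Icc hT2)
  have hVu : ∀ s ∈ Ico 0 (T / 2), V s = u (s + T / 2) := fun s hs =>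
    heq (s + T / 2) ⟨by linarith [hs.1], by linarith [hs.2]⟩
  have hV0 : V 0 = u (T / 2) := by rw [hVu 0 ⟨le_rfl, hT2⟩, zero_add]
  -- its datum `u(T/2)` is `H^∞` (Tao's Cor. 11.1 on `[0, T/2]`)
  have hH1 : HasBoundedSobolevNormsOn (Icc 0 (T / 2)) u :=
    hcl1.hasBoundedSobolevNormsOn_of_sobolevDatum_unforced hν hT2 hE1 h₀
  have h₀V : ∀ m : ℕ, ∫⁻ x, ‖iteratedFDeriv ℝ m (V 0) x‖ₑ ^ 2 < ⊤ := fun m => by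
    obtain ⟨C, hC⟩ := hH1 m
    rw [hV0]
    exact (hC (T / 2) ⟨hT2.le, le_rfl⟩).trans_lt ENNReal.coe_lt_top
  -- its energy on `[0, T/2]`: that of `u` before the endpoint, Fatou at the endpoint
  have hEV_Ico : ∀ s ∈ Ico 0 (T / 2), ∫⁻ x, ‖V s x‖ₑ ^ 2 ≤ A := fun s hs => by
    rw [hVu s hs]
    exact hb (s + T / 2) ⟨by linarith [hs.1], by linarith [hs.2]⟩
  have hEV : ∃ C : ℝ≥0, ∀ s ∈ Icc 0 (T / 2), ∫⁻ x, ‖V s x‖ₑ ^ 2 ≤ C := by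
    refine ⟨A.toNNReal, fun s hs => ?_⟩
    rw [ENNReal.coe_toNNReal hA.ne]
    rcases hs.2.lt_or_eq with hs2 | hs2
    · exact hEV_Ico s ⟨hs.1, hs2⟩
    · rw [hs2]
      exact lintegral_enorm_sq_endpoint_le hT2 hVcl.smooth_velocity hEV_Ico
  obtain ⟨B₂, -, hB₂⟩ := hVcl.exists_norm_iteratedFDeriv_le_of_sobolevDatum hν hT2 hEV h₀V hf0 0
  -- assemble
  refine ⟨max B₁ B₂, fun t ht x => ?_⟩
  rcases le_or_gt t (T / 2) with h1 | h2
  · have := hB₁ t ⟨ht.1, h1⟩ x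
    rw [norm_iteratedFDeriv_zero] at this
    exact this.trans (le_max_left _ _)
  · have hs : t - T / 2 ∈ Ico 0 (T / 2) := ⟨by linarith, by linarith [ht.2]⟩
    have hVt : V (t - T / 2) = u t := by rw [hVu _ hs, sub_add_cancel]
    have := hB₂ (t - T / 2) (Ico_subset_Icc_self hs) x
    rw [norm_iteratedFDeriv_zero, hVt] at this
    exact this.trans (le_max_right _ _)

end Continuation

end Literature.Analysis.FluidPDE

end

-- WHAT THIS IS NOT: not a claim about NS regularity or blow-up; not a claim about any author beyond
-- the typed locator.
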